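import Summits.BirchSwinnertonDyer.BirchSwinnertonDyer.Theorems.ClassRecordThreeEulerHalvesAtThreeCartanSupplyCubicPoints
import Summits.BirchSwinnertonDyer.BirchSwinnertonDyer.Theorems.ClassRecordThreeEulerHalvesAtThreeCartanSupplyKernelCounts
import HarnessLib

/-!
# Fixed points on the cubic points, I: `#{x ∈ GL₂(𝔽_q) : x⁻¹ g x ∈ H} = (q² − q) · #{v ≠ 0 : g v = a v, ∃ u, u³ det g = a²}`

Helper file `--supports stmt-BirchSwinnertonDyer-23422` (seat `bsd-stepL-tam3-p1` g23, LINE OWNER of crux 23422 `EulerHalvesAtThreeResidualUpperBound`,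
line `cartan` v11), serving the registered stub (SUPPLY) `stub_cartanTorusLatticeSupply : CartanCorrespondence.CartanTorusLatticeSupply` via
`HOME/tam3-p1/g23/SUPPLY-ROAD-GG1.md` §1–§2. With `…CubicPoints` (`natCard_conj_mem_eq`, `inv_mul_mul_mem_cubicBorel_iff`) the number of fixed points of
`g` on the cubic points `GL₂(𝔽_q) ⧸ cubicBorel q` is `#{x : x⁻¹ g x ∈ H} / #H`; THIS FILE counts `#{x : x⁻¹ g x ∈ H}` by FIBERING OVER THE FIRST COLUMN:
an invertible matrix is a pair (first column `v ≠ 0`, second column `w` not collinear with `v`), the condition depends on `v` only, and each admissible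
`v` has `q² − q` completions (`…KernelCounts.card_not_collinear`):
**`#{x : x⁻¹ g x ∈ H} = (q² − q) · #{v ≠ 0 : ∃ a, g v = a v ∧ ∃ u, u³ det g = a²}`** (`natCard_conj_mem_cubicBorel_eq`).
(Part II, next file: the eigenvector count by matrix type, `3(q+1)·#H ∣ 3·#H ∣ 6·[λ/μ cube]·#H ∣ 0`, hence `π_C − π_{ℙ¹} = 2χ_W`.)
No definitions (the second column is attached by `Matrix.of`).
HONEST FRAMING: finite-field counting; nothing about SUPPLY, NUM, crux 23422 ∕ 19109 is proved here; BSD is proved for no curve. [folklore]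
-/

namespace Summit.BirchSwinnertonDyer.BirchSwinnertonDyer.Theorems.CartanSupply.CubicPointsFixed

open Summit.BirchSwinnertonDyer.BirchSwinnertonDyer.Theorems.CartanDegree
open Summit.BirchSwinnertonDyer.BirchSwinnertonDyer.Theorems.CartanTorusCubeCut
open Summit.BirchSwinnertonDyer.BirchSwinnertonDyer.Theorems.CartanSupply.CubicPoints
open Summit.BirchSwinnertonDyer.BirchSwinnertonDyer.Theorems.CartanSupply.KernelCounts

set_option linter.dupNamespace false
set_option autoImplicit false

open scoped Classical

variable {q : ℕ} [Fact q.Prime]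

/-! ## §1 Matrices as pairs of columns -/

/-- PROVED: the first column as `mulVec` of `e₀`. [folklore] -/
theorem mulVec_single_zero (M : Mat q) : M.mulVec (Pi.single 0 1) = fun i => M i 0 := by
  funext i
  simp [Matrix.mulVec, dotProduct, Pi.single_apply]

omit [Fact q.Prime] in
/-- PROVED: a `2 × 2` matrix is determined by its two columns: `M = of (j = 0 ? M·0 : M·1)`. [folklore] -/
theorem eq_of_cols (M : Mat q) :
    M = Matrix.of (fun i j : Fin 2 => if j = 0 then M i 0 else M i 1) := by
  ext i j
  fin_cases j <;> simp

/-- PROVED: the determinant of the matrix with columns `v`, `w`. [folklore] -/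
theorem det_of_cols (v w : Fin 2 → ZMod q) :
    (Matrix.of (fun i j : Fin 2 => if j = 0 then v i else w i) : Mat q).det = v 0 * w 1 - v 1 * w 0 := by
  rw [Matrix.det_fin_two]
  simp
  ring

/-- PROVED: for fixed first column `v`, the matrices `M` with first column `v` satisfying a condition `R` on the second column are in bijection with the
second columns: `#{M : M·0 = v ∧ R(M·1)} = #{w : R w}`. [folklore] -/
theorem card_filter_col_eq (v : Fin 2 → ZMod q) (R : (Fin 2 → ZMod q) → Prop) :
    (Finset.univ.filter fun M : Mat q => (fun i => M i 0) = v ∧ R (fun i => M i 1)).card =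
      (Finset.univ.filter fun w : Fin 2 → ZMod q => R w).card := by
  rw [← Finset.card_image_of_injective (Finset.univ.filter fun w : Fin 2 → ZMod q => R w)
    (f := fun w : Fin 2 → ZMod q => (Matrix.of (fun i j : Fin 2 => if j = 0 then v i else w i) : Mat q)) ?_]
  · congr 1
    ext M
    simp only [Finset.mem_filter, Finset.mem_univ, true_and, Finset.mem_image]
    constructor
    · rintro ⟨hv, hR⟩
      refine ⟨fun i => M i 1, hR, ?_⟩
      subst hv
      ext i j
      fin_cases j <;> simp
    · rintro ⟨w, hR, rfl⟩
      have hw : (fun i => (Matrix.of (fun i j : Fin 2 => if j = 0 then v i else w i) : Mat q) i 1) = w := by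
        funext i; simp
      refine ⟨?_, ?_⟩
      · funext i; simp
      · rw [hw]; exact hR
  · intro w₁ w₂ h
    funext i
    have := congrFun (congrFun h i) 1
    simpa using this

/-! ## §2 The count -/

/-- PROVED: the eigenvector condition of `…CubicPoints`, read on the first column `v = (x₀₀, x₁₀)`. [folklore] -/
theorem conj_mem_iff_col (g x : G q) :
    x⁻¹ * g * x ∈ cubicBorel q ↔
      ∃ a : ZMod q, (g : Mat q).mulVec (fun i => (x : Mat q) i 0) = a • (fun i => (x : Mat q) i 0) ∧
        ∃ u : ZMod q, u ^ 3 * (g : Mat q).det = a ^ 2 := by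
  rw [inv_mul_mul_mem_cubicBorel_iff, mulVec_single_zero]

/-- PROVED — **FIBERING OVER THE FIRST COLUMN**: `#{x ∈ GL₂(𝔽_q) : x⁻¹ g x ∈ H} = (q² − q) · #{v ≠ 0 : ∃ a, g v = a v ∧ ∃ u, u³ det g = a²}`.
[folklore] -/
theorem natCard_conj_mem_cubicBorel_eq (g : G q) :
    Nat.card {x : G q // x⁻¹ * g * x ∈ cubicBorel q} =
      (q ^ 2 - q) * (Finset.univ.filter fun v : Fin 2 → ZMod q => v ≠ 0 ∧
        ∃ a : ZMod q, (g : Mat q).mulVec v = a • v ∧ ∃ u : ZMod q, u ^ 3 * (g : Mat q).det = a ^ 2).card := by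
  -- abbreviation for the column condition
  let P : (Fin 2 → ZMod q) → Prop := fun v =>
    ∃ a : ZMod q, (g : Mat q).mulVec v = a • v ∧ ∃ u : ZMod q, u ^ 3 * (g : Mat q).det = a ^ 2
  -- (1) pass from `GL₂` to matrices with non-zero determinant
  have e : {x : G q // x⁻¹ * g * x ∈ cubicBorel q} ≃ {M : Mat q // M.det ≠ 0 ∧ P (fun i => M i 0)} :=
    { toFun := fun x => ⟨(x.1 : Mat q), by
          refine ⟨?_, (conj_mem_iff_col g x.1).mp x.2⟩
          rw [← Matrix.GeneralLinearGroup.val_det_apply]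
          exact (Matrix.GeneralLinearGroup.det x.1).ne_zero⟩
      invFun := fun M => ⟨Matrix.GeneralLinearGroup.mkOfDetNeZero M.1 M.2.1, by
          rw [conj_mem_iff_col]
          exact M.2.2⟩
      left_inv := fun x => by
        apply Subtype.ext
        apply Units.ext
        rfl
      right_inv := fun M => by
        apply Subtype.ext
        rfl }
  rw [Nat.card_congr e, Nat.card_eq_fintype_card, Fintype.card_subtype]
  -- (2) fibre over the first column
  rw [Finset.card_eq_sum_card_fiberwise (f := fun M : Mat q => (fun i => M i 0)) (t := Finset.univ) (fun _ _ => Finset.mem_univ _)]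
  -- each fibre: `#{M : M·0 = v, det M ≠ 0, P v} = [P v] · #{w : v₀ w₁ − v₁ w₀ ≠ 0}`
  have hfib : ∀ v : Fin 2 → ZMod q,
      ((Finset.univ.filter fun M : Mat q => M.det ≠ 0 ∧ P (fun i => M i 0)).filter fun M => (fun i => M i 0) = v).card =
        if v ≠ 0 ∧ P v then q ^ 2 - q else 0 := by
    intro v
    rw [Finset.filter_filter]
    by_cases hP : P v
    · -- the fibre is `{M : M·0 = v ∧ det ≠ 0}`
      have : (Finset.univ.filter fun M : Mat q => (M.det ≠ 0 ∧ P (fun i => M i 0)) ∧ (fun i => M i 0) = v) =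
          Finset.univ.filter fun M : Mat q => (fun i => M i 0) = v ∧ v 0 * M 1 1 ≠ v 1 * M 0 1 := by
        apply Finset.filter_congr
        intro M _
        constructor
        · rintro ⟨⟨hdet, -⟩, hv⟩
          have hv0 : M 0 0 = v 0 := congrFun hv 0
          have hv1 : M 1 0 = v 1 := congrFun hv 1
          refine ⟨hv, ?_⟩
          rw [Matrix.det_fin_two, hv0, hv1] at hdet
          exact fun h => hdet (by linear_combination h)
        · rintro ⟨hv, hne⟩
          have hv0 : M 0 0 = v 0 := congrFun hv 0
          have hv1 : M 1 0 = v 1 := congrFun hv 1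
          refine ⟨⟨?_, hv ▸ hP⟩, hv⟩
          rw [Matrix.det_fin_two, hv0, hv1]
          exact fun h0 => hne (by linear_combination h0)
      have hc := card_filter_col_eq (q := q) v (fun w => v 0 * w 1 ≠ v 1 * w 0)
      beta_reduce at hc
      have hc' : (Finset.univ.filter fun M : Mat q => (fun i => M i 0) = v ∧ v 0 * M 1 1 ≠ v 1 * M 0 1).card =
          (Finset.univ.filter fun w : Fin 2 → ZMod q => v 0 * w 1 ≠ v 1 * w 0).card := by convert hc using 3
      rw [this, hc']
      by_cases hv : v ≠ 0
      · rw [if_pos ⟨hv, hP⟩, card_not_collinear v hv]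
      · rw [if_neg (fun h => hv h.1)]
        push Not at hv
        subst hv
        simp
    · rw [if_neg (fun h => hP h.2)]
      rw [Finset.card_eq_zero, Finset.filter_eq_empty_iff]
      rintro M - ⟨⟨-, hPM⟩, hv⟩
      exact hP (hv ▸ hPM)
  simp_rw [hfib]
  rw [← Finset.sum_filter, Finset.sum_const, smul_eq_mul, mul_comm]

end Summit.BirchSwinnertonDyer.BirchSwinnertonDyer.Theorems.CartanSupply.CubicPointsFixed
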